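import Mathlib
import Literature.MathematicalPhysics.QuantumFieldTheory.U1GinibreComparison
import Summits.QuantumFields.YangMills.Theses.TransverseWardBL
import Summits.QuantumFields.YangMills.Theorems.TransverseWardBLTorusMeanPlaqLower

/-!
# TransverseWardBL — split child `DefectTail` PROVED (Ginibre coupling tilt; every torus, both parities)

Route `route-QuantumFields-TransverseWardBL` (D-0145 LINE g9-A/B, ideator seat ym-idea-4 g9), split child
`DefectTail` (stmt-QuantumFields-23008) of the deciding crux `LargeFieldInsensitivity`:

  `∃ κ > 0, ∃ β₁, ∀ β > β₁, ∀ M P, W_{β,M}[∏_{p ∈ P} 1{Re U_p < cos 1}] ≤ exp(−κ β #P)`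

for Wilson `U(1)₄` on the torus `(ℤ/(M+1)ℤ)⁴`.  Proved here with `κ = (9/10 − cos 1)/4`, `β₁ = 42`, with NO
chessboard / reflection positivity and hence no parity restriction on the torus side:

* `tail_core` — Chebyshev `∏_{p∈P} 1{Re U_p < cos 1} ≤ exp(t ∑_{p∈P}(cos 1 − Re U_p))` (`t ≥ 0`); the
  coupling tilt `W_β[exp(−t ∑_P Re U_p)] = Z(J')/Z(β)`, `J'` lowering the couplings on `P` from `β` to `β − t`
  (`ginibreWeight_add`); Jensen by the tangent line `Z(β) = ∫ e^{tS} w_{J'} ≥ e^{t⟨S⟩_{J'}} Z(J')`,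
  `S = ∑_P Re U_p`; and Ginibre's inequality in the couplings (tree `ginibreExpect_reChar_mono`):
  `⟨Re U_p⟩_{J'} ≥ ⟨Re U_p⟩_{β−t} ≥ 9/10`; so the tail is `≤ exp(−t (9/10 − cos 1) #P)`;
* `allPlaqMeanLower_proof` — the uniform one-point input `⟨Re U_p⟩_{β,M} ≥ 9/10` for EVERY plaquette of
  every torus at `β > 20`: Ginibre switch-off down to the single plaquette `p`, whose mean is `I₁(β)/I₀(β)` by
  the character expansion (tree `TransverseWardBL.ginibreExpect_single_self`; the plaquette character has
  infinite order on every torus of side `≥ 2`, `u1PlaqChar_zpow_eq_one_of`), Amos' bound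
  (tree `TransverseWardBL.besselRatio_ge`), and the trivial side-1 torus;
* `defectTail_of_allPlaqMeanLower` + `defectTail_proof` — `t = β − 21 ≥ β/2` for `β > 42`.

Honest scope: an elementary abelian large-field estimate inside a COMPARISON line (Wilson `U(1)₄`); it proves
no rung of `YangMills`; the transverse-response half `ResponseFromTail` (stmt-QuantumFields-23009) is untouched.
-/
noncomputable section

open MeasureTheory Finset
open Literature.Probability.LatticeModels Literature.MathematicalPhysics.QuantumFieldTheory
  Literature.MathematicalPhysics.QuantumLattice

namespace Summit.QuantumFields.YangMills.Theorems.TransverseWardBLDefect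

variable {M : ℕ}

/-- `Re χ_p(U) = Re U_p` for the torus plaquette characters. [folklore] -/
theorem reChar_u1TorusChars (p : Plaquette 4 (M + 1)) (U : GaugeConfig 4 (M + 1) Circle) :
    reChar (u1TorusChars M p) U = ((plaquetteHolonomy U p.1 p.2.1.1 p.2.1.2 : Circle) : ℂ).re := rfl

/-- **Every torus `U(1)₄` Wilson expectation is a Ginibre expectation** with constant couplings
(the tree's `wilsonExpectation_u1_eq_ginibreExpect`, for an arbitrary observable). [folklore] -/
theorem wilsonExpectation_u1_eq_ginibreExpect_fun (β : ℝ) (M : ℕ)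
    (F : GaugeConfig 4 (M + 1) Circle → ℝ) :
    wilsonExpectation (L := M + 1) u1Rep β F =
      ginibreExpect (Measure.pi fun _ : Edge 4 (M + 1) => haarProbability Circle) (u1TorusChars M) (fun _ => β) F := by
  rw [wilsonExpectation_eq_div_integral u1Rep continuous_u1Rep, ginibreExpect]
  simp_rw [exp_neg_mul_wilsonAction_u1]
  set c := Real.exp (-β * Fintype.card (Plaquette 4 (M + 1)))
  have hc : c ≠ 0 := (Real.exp_pos _).ne'
  simp_rw [mul_left_comm _ c, integral_const_mul]
  rw [mul_div_mul_left _ _ hc]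

/-- The Ginibre weight is continuous, hence integrable on the compact configuration group. [folklore] -/
theorem integrable_mul_ginibreWeight (J : Plaquette 4 (M + 1) → ℝ)
    {F : GaugeConfig 4 (M + 1) Circle → ℝ} (hF : Continuous F) :
    Integrable (fun U => F U * ginibreWeight (u1TorusChars M) J U) (Measure.pi fun _ : Edge 4 (M + 1) => haarProbability Circle) :=
  integrable_of_continuous_compactSpace _ (hF.mul (continuous_ginibreWeight _ _))

/-- `Z(J) > 0`. [folklore] -/
theorem integral_ginibreWeight_pos (J : Plaquette 4 (M + 1) → ℝ) :
    0 < ∫ U, ginibreWeight (u1TorusChars M) J U ∂(Measure.pi fun _ : Edge 4 (M + 1) => haarProbability Circle) :=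
  integral_exp_pos (integrable_of_continuous_compactSpace _ (continuous_ginibreWeight _ _))

/-- `cos 1 < 9/10`. [folklore] -/
theorem cos_one_lt : Real.cos 1 < 9 / 10 := by
  have h := Real.cos_bound (x := 1) (by norm_num)
  have h' := (abs_le.1 h).2
  norm_num at h'
  linarith

/-- Chebyshev, pointwise: `∏_{p∈P} 1{Re U_p < cos 1} ≤ exp(t ∑_{p∈P} (cos 1 − Re U_p))` for `t ≥ 0`.
[folklore] -/
theorem prod_indicator_le_exp (P : Finset (Plaquette 4 (M + 1))) {t : ℝ} (ht : 0 ≤ t)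
    (U : GaugeConfig 4 (M + 1) Circle) :
    (∏ p ∈ P, (if ((plaquetteHolonomy U p.1 p.2.1.1 p.2.1.2 : Circle) : ℂ).re < Real.cos 1
        then (1 : ℝ) else 0)) ≤
      Real.exp (t * ∑ p ∈ P, (Real.cos 1 - reChar (u1TorusChars M p) U)) := by
  by_cases h : ∀ p ∈ P, ((plaquetteHolonomy U p.1 p.2.1.1 p.2.1.2 : Circle) : ℂ).re < Real.cos 1
  · have h1 : (∏ p ∈ P, (if ((plaquetteHolonomy U p.1 p.2.1.1 p.2.1.2 : Circle) : ℂ).re < Real.cos 1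
        then (1 : ℝ) else 0)) = 1 :=
      Finset.prod_eq_one fun p hp => by rw [if_pos (h p hp)]
    rw [h1]
    refine Real.one_le_exp (mul_nonneg ht (Finset.sum_nonneg fun p hp => ?_))
    have := h p hp
    rw [reChar_u1TorusChars]
    linarith
  · push Not at h
    obtain ⟨p, hp, hge⟩ := h
    have h0 : (∏ p ∈ P, (if ((plaquetteHolonomy U p.1 p.2.1.1 p.2.1.2 : Circle) : ℂ).re < Real.cos 1
        then (1 : ℝ) else 0)) = 0 :=
      Finset.prod_eq_zero hp (by rw [if_neg (not_lt.2 hge)])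
    rw [h0]
    exact (Real.exp_pos _).le

/-- The indicator product lies in `[0, 1]`. [folklore] -/
theorem prod_indicator_mem (P : Finset (Plaquette 4 (M + 1))) (U : GaugeConfig 4 (M + 1) Circle) :
    0 ≤ (∏ p ∈ P, (if ((plaquetteHolonomy U p.1 p.2.1.1 p.2.1.2 : Circle) : ℂ).re < Real.cos 1
        then (1 : ℝ) else 0)) ∧
    (∏ p ∈ P, (if ((plaquetteHolonomy U p.1 p.2.1.1 p.2.1.2 : Circle) : ℂ).re < Real.cos 1
        then (1 : ℝ) else 0)) ≤ 1 := by
  refine ⟨Finset.prod_nonneg fun p _ => ?_, Finset.prod_le_one (fun p _ => ?_) fun p _ => ?_⟩ <;>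
    split_ifs <;> norm_num

/-- The indicator product is measurable. [folklore] -/
theorem measurable_prod_indicator (P : Finset (Plaquette 4 (M + 1))) :
    Measurable fun U : GaugeConfig 4 (M + 1) Circle =>
      ∏ p ∈ P, (if ((plaquetteHolonomy U p.1 p.2.1.1 p.2.1.2 : Circle) : ℂ).re < Real.cos 1
        then (1 : ℝ) else 0) := by
  refine Finset.measurable_prod _ fun p _ => Measurable.ite ?_ measurable_const measurable_const
  have hc : Continuous fun U : GaugeConfig 4 (M + 1) Circle => reChar (u1TorusChars M p) U :=
    continuous_reChar _
  exact measurableSet_lt hc.measurable measurable_const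

/-- **The core tail estimate at couplings `β_* + t`**: if every plaquette of `P` has mean `≥ 9/10` at the
LOWER coupling `β_* ≥ 0`, then `W_{β_*+t}[∏_{p∈P} 1{Re U_p < cos 1}] ≤ exp(−t (9/10 − cos 1) #P)` for
`t ≥ 0` (Chebyshev + coupling tilt + Jensen + Ginibre). [folklore] -/
theorem tail_core (M : ℕ) (P : Finset (Plaquette 4 (M + 1))) {βs t : ℝ} (hβs : 0 ≤ βs) (ht : 0 ≤ t)
    (hm : ∀ p ∈ P, (9 / 10 : ℝ) ≤ wilsonExpectation (L := M + 1) u1Rep βs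
      (fun U : GaugeConfig 4 (M + 1) Circle =>
        ((plaquetteHolonomy U p.1 p.2.1.1 p.2.1.2 : Circle) : ℂ).re)) :
    wilsonExpectation (L := M + 1) u1Rep (βs + t)
        (fun U => ∏ p ∈ P, (if ((plaquetteHolonomy U p.1 p.2.1.1 p.2.1.2 : Circle) : ℂ).re < Real.cos 1
          then (1 : ℝ) else 0)) ≤
      Real.exp (-(t * (9 / 10 - Real.cos 1) * (P.card : ℝ))) := by
  -- notation
  let S : GaugeConfig 4 (M + 1) Circle → ℝ := fun U => ∑ p ∈ P, reChar ((u1TorusChars M) p) U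
  let K : Plaquette 4 (M + 1) → ℝ := fun q => if q ∈ P then -t else 0
  let J' : Plaquette 4 (M + 1) → ℝ := (fun _ => βs + t) + K
  let ind : GaugeConfig 4 (M + 1) Circle → ℝ := fun U =>
    ∏ p ∈ P, (if ((plaquetteHolonomy U p.1 p.2.1.1 p.2.1.2 : Circle) : ℂ).re < Real.cos 1
      then (1 : ℝ) else 0)
  let g : GaugeConfig 4 (M + 1) Circle → ℝ := fun U =>
    Real.exp (t * ∑ p ∈ P, (Real.cos 1 - reChar ((u1TorusChars M) p) U))
  have hSc : Continuous S := continuous_finsetSum _ fun p _ => continuous_reChar _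
  have hgc : Continuous g :=
    Real.continuous_exp.comp (continuous_const.mul
      (continuous_finsetSum _ fun p _ => continuous_const.sub (continuous_reChar _)))
  -- the weights
  have hwK : ∀ U, ginibreWeight (u1TorusChars M) K U = Real.exp (-t * S U) := fun U => by
    simp only [ginibreWeight, ginibreHamiltonian, K, S, ite_mul, zero_mul, Finset.sum_ite_mem,
      Finset.univ_inter, Finset.mul_sum, neg_mul]
  have hwJ' : ∀ U, ginibreWeight (u1TorusChars M) J' U = ginibreWeight (u1TorusChars M) (fun _ => βs + t) U * Real.exp (-t * S U) :=
    fun U => by rw [show J' = (fun _ => βs + t) + K from rfl, ginibreWeight_add, hwK]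
  have hwβ : ∀ U, ginibreWeight (u1TorusChars M) (fun _ => βs + t) U = ginibreWeight (u1TorusChars M) J' U * Real.exp (t * S U) :=
    fun U => by
      rw [hwJ', mul_assoc, ← Real.exp_add]
      simp
  have hg : ∀ U, g U * ginibreWeight (u1TorusChars M) (fun _ => βs + t) U =
      Real.exp (t * Real.cos 1 * P.card) * ginibreWeight (u1TorusChars M) J' U := fun U => by
    have : g U = Real.exp (t * Real.cos 1 * P.card) * Real.exp (-t * S U) := by
      simp only [g, S, Finset.sum_sub_distrib, Finset.sum_const, nsmul_eq_mul, ← Real.exp_add]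
      ring_nf
    rw [this, hwJ']
    ring
  -- partition functions
  have hZpos : 0 < ∫ U, ginibreWeight (u1TorusChars M) (fun _ => βs + t) U ∂(Measure.pi fun _ : Edge 4 (M + 1) => haarProbability Circle) := integral_ginibreWeight_pos _
  have hZ'pos : 0 < ∫ U, ginibreWeight (u1TorusChars M) J' U ∂(Measure.pi fun _ : Edge 4 (M + 1) => haarProbability Circle) := integral_ginibreWeight_pos _
  -- integrability facts
  have hw_int : ∀ J : Plaquette 4 (M + 1) → ℝ, Integrable (fun U => ginibreWeight (u1TorusChars M) J U) (Measure.pi fun _ : Edge 4 (M + 1) => haarProbability Circle) := fun J =>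
    integrable_of_continuous_compactSpace _ (continuous_ginibreWeight _ _)
  have hSw_int : Integrable (fun U => S U * ginibreWeight (u1TorusChars M) J' U) (Measure.pi fun _ : Edge 4 (M + 1) => haarProbability Circle) := integrable_mul_ginibreWeight J' hSc
  -- (1) Chebyshev under the expectation
  have h1 : wilsonExpectation (L := M + 1) u1Rep (βs + t) ind ≤
      wilsonExpectation (L := M + 1) u1Rep (βs + t) g := by
    rw [wilsonExpectation_u1_eq_ginibreExpect_fun, wilsonExpectation_u1_eq_ginibreExpect_fun,
      ginibreExpect, ginibreExpect]
    refine div_le_div_of_nonneg_right (integral_mono ?_ (integrable_mul_ginibreWeight _ hgc)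
      fun U => ?_) hZpos.le
    · refine (hw_int (fun _ => βs + t)).mono'
        ((measurable_prod_indicator P).aestronglyMeasurable.mul
          (continuous_ginibreWeight _ _).aestronglyMeasurable) (ae_of_all _ fun U => ?_)
      have h01 := prod_indicator_mem P U
      have hwpos : 0 < ginibreWeight (u1TorusChars M) (fun _ => βs + t) U := Real.exp_pos _
      rw [Real.norm_eq_abs, abs_mul, abs_of_nonneg h01.1, abs_of_pos hwpos]
      calc ind U * ginibreWeight (u1TorusChars M) (fun _ => βs + t) U ≤ 1 * ginibreWeight (u1TorusChars M) (fun _ => βs + t) U :=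
            mul_le_mul_of_nonneg_right h01.2 (Real.exp_pos _).le
        _ = ginibreWeight (u1TorusChars M) (fun _ => βs + t) U := one_mul _
    · exact mul_le_mul_of_nonneg_right (prod_indicator_le_exp P ht U) (Real.exp_pos _).le
  -- (2) the tilt identity
  have h2 : wilsonExpectation (L := M + 1) u1Rep (βs + t) g =
      Real.exp (t * Real.cos 1 * P.card) *
        ((∫ U, ginibreWeight (u1TorusChars M) J' U ∂(Measure.pi fun _ : Edge 4 (M + 1) => haarProbability Circle)) / ∫ U, ginibreWeight (u1TorusChars M) (fun _ => βs + t) U ∂(Measure.pi fun _ : Edge 4 (M + 1) => haarProbability Circle)) := by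
    rw [wilsonExpectation_u1_eq_ginibreExpect_fun, ginibreExpect]
    simp_rw [hg, integral_const_mul]
    rw [mul_div_assoc]
  -- (3) Jensen by the tangent line: Z(β) ≥ e^{t m} Z(J')
  set m : ℝ := (∫ U, S U * ginibreWeight (u1TorusChars M) J' U ∂(Measure.pi fun _ : Edge 4 (M + 1) => haarProbability Circle)) / ∫ U, ginibreWeight (u1TorusChars M) J' U ∂(Measure.pi fun _ : Edge 4 (M + 1) => haarProbability Circle) with hm_def
  have hmZ : m * ∫ U, ginibreWeight (u1TorusChars M) J' U ∂(Measure.pi fun _ : Edge 4 (M + 1) => haarProbability Circle) = ∫ U, S U * ginibreWeight (u1TorusChars M) J' U ∂(Measure.pi fun _ : Edge 4 (M + 1) => haarProbability Circle) :=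
    div_mul_cancel₀ _ hZ'pos.ne'
  have h3 : Real.exp (t * m) * ∫ U, ginibreWeight (u1TorusChars M) J' U ∂(Measure.pi fun _ : Edge 4 (M + 1) => haarProbability Circle) ≤
      ∫ U, ginibreWeight (u1TorusChars M) (fun _ => βs + t) U ∂(Measure.pi fun _ : Edge 4 (M + 1) => haarProbability Circle) := by
    have hlin : ∫ U, Real.exp (t * m) * (1 + t * (S U - m)) * ginibreWeight (u1TorusChars M) J' U ∂(Measure.pi fun _ : Edge 4 (M + 1) => haarProbability Circle) =
        Real.exp (t * m) * ∫ U, ginibreWeight (u1TorusChars M) J' U ∂(Measure.pi fun _ : Edge 4 (M + 1) => haarProbability Circle) := by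
      have e1 : (fun U => Real.exp (t * m) * (1 + t * (S U - m)) * ginibreWeight (u1TorusChars M) J' U) =
          fun U => Real.exp (t * m) * (1 - t * m) * ginibreWeight (u1TorusChars M) J' U +
            Real.exp (t * m) * t * (S U * ginibreWeight (u1TorusChars M) J' U) := funext fun U => by ring
      rw [e1, integral_add ((hw_int J').const_mul _) (hSw_int.const_mul _), integral_const_mul,
        integral_const_mul, ← hmZ]
      ring
    have hf_int : Integrable
        (fun U => Real.exp (t * m) * (1 + t * (S U - m)) * ginibreWeight (u1TorusChars M) J' U) (Measure.pi fun _ : Edge 4 (M + 1) => haarProbability Circle) :=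
      integrable_of_continuous_compactSpace _
        ((continuous_const.mul (continuous_const.add (continuous_const.mul
          (hSc.sub continuous_const)))).mul (continuous_ginibreWeight _ _))
    have he_int : Integrable (fun U => Real.exp (t * S U) * ginibreWeight (u1TorusChars M) J' U) (Measure.pi fun _ : Edge 4 (M + 1) => haarProbability Circle) :=
      integrable_of_continuous_compactSpace _
        ((Real.continuous_exp.comp (continuous_const.mul hSc)).mul (continuous_ginibreWeight _ _))
    calc Real.exp (t * m) * ∫ U, ginibreWeight (u1TorusChars M) J' U ∂(Measure.pi fun _ : Edge 4 (M + 1) => haarProbability Circle)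
        = ∫ U, Real.exp (t * m) * (1 + t * (S U - m)) * ginibreWeight (u1TorusChars M) J' U ∂(Measure.pi fun _ : Edge 4 (M + 1) => haarProbability Circle) := hlin.symm
      _ ≤ ∫ U, Real.exp (t * S U) * ginibreWeight (u1TorusChars M) J' U ∂(Measure.pi fun _ : Edge 4 (M + 1) => haarProbability Circle) := by
          refine integral_mono hf_int he_int fun U => ?_
          have hx := Real.add_one_le_exp (t * (S U - m))
          have e : Real.exp (t * S U) = Real.exp (t * m) * Real.exp (t * (S U - m)) := by
            rw [← Real.exp_add]; ring_nf
          rw [e]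
          exact mul_le_mul_of_nonneg_right
            (mul_le_mul_of_nonneg_left (by linarith) (Real.exp_pos _).le) (Real.exp_pos _).le
      _ = ∫ U, ginibreWeight (u1TorusChars M) (fun _ => βs + t) U ∂(Measure.pi fun _ : Edge 4 (M + 1) => haarProbability Circle) := by
          refine integral_congr_ae (ae_of_all _ fun U => ?_)
          rw [hwβ U, mul_comm]
  have hZZ : (∫ U, ginibreWeight (u1TorusChars M) J' U ∂(Measure.pi fun _ : Edge 4 (M + 1) => haarProbability Circle)) / (∫ U, ginibreWeight (u1TorusChars M) (fun _ => βs + t) U ∂(Measure.pi fun _ : Edge 4 (M + 1) => haarProbability Circle)) ≤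
      Real.exp (-(t * m)) := by
    rw [div_le_iff₀ hZpos]
    calc (∫ U, ginibreWeight (u1TorusChars M) J' U ∂(Measure.pi fun _ : Edge 4 (M + 1) => haarProbability Circle))
        = Real.exp (-(t * m)) * (Real.exp (t * m) * ∫ U, ginibreWeight (u1TorusChars M) J' U ∂(Measure.pi fun _ : Edge 4 (M + 1) => haarProbability Circle)) := by
          rw [← mul_assoc, ← Real.exp_add]; simp
      _ ≤ Real.exp (-(t * m)) * ∫ U, ginibreWeight (u1TorusChars M) (fun _ => βs + t) U ∂(Measure.pi fun _ : Edge 4 (M + 1) => haarProbability Circle) :=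
          mul_le_mul_of_nonneg_left h3 (Real.exp_pos _).le
  -- (4) Ginibre: m ≥ (9/10) #P
  have h4 : (9 / 10 : ℝ) * P.card ≤ m := by
    have hsum : ∫ U, S U * ginibreWeight (u1TorusChars M) J' U ∂(Measure.pi fun _ : Edge 4 (M + 1) => haarProbability Circle) =
        ∑ p ∈ P, ∫ U, reChar ((u1TorusChars M) p) U * ginibreWeight (u1TorusChars M) J' U ∂(Measure.pi fun _ : Edge 4 (M + 1) => haarProbability Circle) := by
      have e : (fun U => S U * ginibreWeight (u1TorusChars M) J' U) =
          fun U => ∑ p ∈ P, reChar ((u1TorusChars M) p) U * ginibreWeight (u1TorusChars M) J' U :=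
        funext fun U => by simp only [S, Finset.sum_mul]
      rw [e, integral_finsetSum P fun p _ => integrable_mul_ginibreWeight J' (continuous_reChar _)]
    have hm' : m = ∑ p ∈ P, ginibreExpect (Measure.pi fun _ : Edge 4 (M + 1) => haarProbability Circle) (u1TorusChars M) J' (reChar ((u1TorusChars M) p)) := by
      rw [hm_def, hsum, Finset.sum_div]
      rfl
    rw [hm']
    have hle : ∀ p ∈ P, (9 / 10 : ℝ) ≤ ginibreExpect (Measure.pi fun _ : Edge 4 (M + 1) => haarProbability Circle) (u1TorusChars M) J' (reChar ((u1TorusChars M) p)) := fun p hp => by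
      have hG := ginibreExpect_reChar_mono (Measure.pi fun _ : Edge 4 (M + 1) => haarProbability Circle) (fun θ => exists_mul_self_eq_u1Config θ) (u1TorusChars M) ((u1TorusChars M) p)
        (J := fun _ => βs) (J' := J') (fun _ => hβs) (fun q => by
          show βs ≤ (βs + t) + (if q ∈ P then -t else 0)
          split_ifs <;> linarith)
      have hW : ginibreExpect (Measure.pi fun _ : Edge 4 (M + 1) => haarProbability Circle) (u1TorusChars M) (fun _ => βs) (reChar ((u1TorusChars M) p)) =
          wilsonExpectation (L := M + 1) u1Rep βs
            (fun U : GaugeConfig 4 (M + 1) Circle =>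
              ((plaquetteHolonomy U p.1 p.2.1.1 p.2.1.2 : Circle) : ℂ).re) := by
        rw [wilsonExpectation_u1_eq_ginibreExpect_fun]
        rfl
      linarith [hm p hp, hW.symm.le, hW.le]
    calc (9 / 10 : ℝ) * P.card = ∑ p ∈ P, (9 / 10 : ℝ) := by
          rw [Finset.sum_const, nsmul_eq_mul, mul_comm]
      _ ≤ ∑ p ∈ P, ginibreExpect (Measure.pi fun _ : Edge 4 (M + 1) => haarProbability Circle) (u1TorusChars M) J' (reChar ((u1TorusChars M) p)) := Finset.sum_le_sum hle
  -- (5) assemble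
  have htm : t * ((9 / 10 : ℝ) * P.card) ≤ t * m := mul_le_mul_of_nonneg_left h4 ht
  calc wilsonExpectation (L := M + 1) u1Rep (βs + t) ind
      ≤ wilsonExpectation (L := M + 1) u1Rep (βs + t) g := h1
    _ = Real.exp (t * Real.cos 1 * P.card) *
          ((∫ U, ginibreWeight (u1TorusChars M) J' U ∂(Measure.pi fun _ : Edge 4 (M + 1) => haarProbability Circle)) / ∫ U, ginibreWeight (u1TorusChars M) (fun _ => βs + t) U ∂(Measure.pi fun _ : Edge 4 (M + 1) => haarProbability Circle)) := h2
    _ ≤ Real.exp (t * Real.cos 1 * P.card) * Real.exp (-(t * m)) :=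
        mul_le_mul_of_nonneg_left hZZ (Real.exp_pos _).le
    _ = Real.exp (t * Real.cos 1 * P.card - t * m) := by rw [← Real.exp_add]; ring_nf
    _ ≤ Real.exp (-(t * (9 / 10 - Real.cos 1) * (P.card : ℝ))) := Real.exp_le_exp.2 (by nlinarith)

/-- **`DefectTail` from the uniform one-plaquette mean bound.** With `β₂` from the one-point bound,
`β_* = max β₂ 0 + 1`, `β₁ = 2β_*` and `κ = (9/10 − cos 1)/4`: for `β > β₁` apply `tail_core` with
`t = β − β_* ≥ β/2`. [folklore] -/
theorem defectTail_of_allPlaqMeanLower (h : ∃ β₂ : ℝ, ∀ β : ℝ, β₂ < β → ∀ M : ℕ, ∀ p : Plaquette 4 (M + 1),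
    (9 / 10 : ℝ) ≤ wilsonExpectation (L := M + 1) u1Rep β
      (fun U : GaugeConfig 4 (M + 1) Circle =>
        ((plaquetteHolonomy U p.1 p.2.1.1 p.2.1.2 : Circle) : ℂ).re)) :
    Summit.QuantumFields.YangMills.Theses.TransverseWardBL.DefectTail := by
  obtain ⟨β₂, hβ₂⟩ := h
  have hcos := cos_one_lt
  refine ⟨(9 / 10 - Real.cos 1) / 4, by linarith, 2 * (max β₂ 0 + 1), fun β hβ M P => ?_⟩
  have hmax0 := le_max_right β₂ 0
  have hmax2 := le_max_left β₂ 0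
  have hβs0 : 0 ≤ max β₂ 0 + 1 := by linarith
  have ht0 : 0 ≤ β - (max β₂ 0 + 1) := by linarith
  have hcore := tail_core M P hβs0 ht0 (fun p _ => hβ₂ _ (by linarith) M p)
  have e : max β₂ 0 + 1 + (β - (max β₂ 0 + 1)) = β := by ring
  rw [e] at hcore
  refine hcore.trans (Real.exp_le_exp.2 ?_)
  have hP : (0 : ℝ) ≤ (P.card : ℝ) := Nat.cast_nonneg _
  have hc₀ : 0 ≤ 9 / 10 - Real.cos 1 := by linarith
  have hq : β / 4 ≤ β - (max β₂ 0 + 1) := by linarith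
  have hk : (9 / 10 - Real.cos 1) / 4 * β * (P.card : ℝ) ≤
      (β - (max β₂ 0 + 1)) * (9 / 10 - Real.cos 1) * (P.card : ℝ) := by
    apply mul_le_mul_of_nonneg_right _ hP
    have e2 : (9 / 10 - Real.cos 1) / 4 * β = (β / 4) * (9 / 10 - Real.cos 1) := by ring
    rw [e2]
    exact mul_le_mul_of_nonneg_right hq hc₀
  linarith


/-! ## The one-point bound itself (Ginibre switch-off + Amos), and the item -/

/-- **Every plaquette character of a torus of side `≥ 2` has infinite order**: test `U ↦ U_{(x;i,j)}` (`i ≠ j`)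
on the configuration `e^{iπ/k}` on the link `(x, i)` and `1` elsewhere — the other three links of the
plaquette are different links (`j ≠ i`, and `x + e_j ≠ x` because `1 ≠ 0` in `ℤ/(M+1)`, `M ≥ 1`).  The tree's
`TransverseWardBL.u1PlaqChar_zpow_eq_one` is the case `x = 0`, `(i,j) = (0,1)`. [folklore] -/
theorem u1PlaqChar_zpow_eq_one_of {M : ℕ} (hM : 1 ≤ M) (x : Site 4 (M + 1)) {i j : Fin 4} (hij : i ≠ j)
    (k : ℤ) (hk : ∀ U : GaugeConfig 4 (M + 1) Circle, (u1PlaqChar x i j U) ^ k = 1) : k = 0 := by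
  by_contra hk0
  haveI : Fact (1 < M + 1) := ⟨by omega⟩
  set e₁ : Edge 4 (M + 1) := (x, i) with he₁
  set U₀ : GaugeConfig 4 (M + 1) Circle := Pi.mulSingle e₁ (Circle.exp (Real.pi / k)) with hU₀
  have h2ne : (x.shift i, j) ≠ e₁ := fun h => hij.symm (congrArg Prod.snd h)
  have h4ne : (x, j) ≠ e₁ := fun h => hij.symm (congrArg Prod.snd h)
  have h3ne : (x.shift j, i) ≠ e₁ := by
    intro h
    have hfst : x.shift j = x := congrArg Prod.fst h
    have h1 : (x.shift j) j = x j := by rw [hfst]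
    simp [Literature.MathematicalPhysics.QuantumFieldTheory.Site.shift] at h1
  have hval : u1PlaqChar x i j U₀ = Circle.exp (Real.pi / k) := by
    rw [u1PlaqChar_apply, plaquetteHolonomy]
    have h1 : U₀ (x, i) = Circle.exp (Real.pi / k) := by rw [hU₀, ← he₁, Pi.mulSingle_eq_same]
    have h2 : U₀ (x.shift i, j) = 1 := by rw [hU₀, Pi.mulSingle_eq_of_ne h2ne]
    have h3 : U₀ (x.shift j, i) = 1 := by rw [hU₀, Pi.mulSingle_eq_of_ne h3ne]
    have h4 : U₀ (x, j) = 1 := by rw [hU₀, Pi.mulSingle_eq_of_ne h4ne]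
    rw [h1, h2, h3, h4]
    simp
  have h := hk U₀
  rw [hval] at h
  have h3 : ((Circle.exp (Real.pi / k) ^ k : Circle) : ℂ) = 1 := by rw [h, Circle.coe_one]
  rw [Circle.coe_zpow, Circle.coe_exp, ← Complex.exp_int_mul] at h3
  have h4 : (k : ℂ) * (((Real.pi / k : ℝ) : ℂ) * Complex.I) = Real.pi * Complex.I := by
    have hk0' : (k : ℂ) ≠ 0 := by exact_mod_cast hk0
    push_cast
    field_simp
  rw [h4, Complex.exp_pi_mul_I] at h3
  norm_num at h3

/-- On the one-site torus every plaquette holonomy of an abelian configuration is trivial (the plaquette reads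
the same two links twice with opposite orientations). [folklore] -/
theorem plaquetteHolonomy_side_one (U : GaugeConfig 4 (0 + 1) Circle) (x : Site 4 (0 + 1)) (i j : Fin 4) :
    plaquetteHolonomy U x i j = 1 := by
  have hsub : ∀ y z : Site 4 (0 + 1), y = z := fun y z => funext fun a =>
    ZMod.val_injective _ (by have := ZMod.val_lt (y a); have := ZMod.val_lt (z a); omega)
  rw [plaquetteHolonomy, hsub (x.shift i) x, hsub (x.shift j) x]
  simp [mul_comm, mul_left_comm]

/-- **The uniform one-point bound** (`β₂ = 20`): for `β > 20`, every torus and every plaquette `p`,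
`⟨Re U_p⟩_{Λ_{M+1},β} ≥ I₁(β)/I₀(β) ≥ 9/10` — Ginibre's monotonicity in the couplings from the torus down
to the single plaquette `p` (couplings `β·1_{p}`), whose mean is `I₁/I₀` by the character expansion
(tree `TransverseWardBL.ginibreExpect_single_self`, the plaquette character having infinite order), and Amos'
bound (tree `TransverseWardBL.besselRatio_ge`); the side-1 torus is trivial. [folklore] -/
theorem allPlaqMeanLower_proof :
    ∃ β₂ : ℝ, ∀ β : ℝ, β₂ < β → ∀ M : ℕ, ∀ p : Plaquette 4 (M + 1),
    (9 / 10 : ℝ) ≤ wilsonExpectation (L := M + 1) u1Rep β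
      (fun U : GaugeConfig 4 (M + 1) Circle =>
        ((plaquetteHolonomy U p.1 p.2.1.1 p.2.1.2 : Circle) : ℂ).re) := by
  refine ⟨20, fun β hβ M p => ?_⟩
  have hβ0 : 0 ≤ β := by linarith
  rcases Nat.eq_zero_or_pos M with hM | hM
  · subst hM
    haveI := isProbabilityMeasure_wilsonMeasure (d := 4) (L := 0 + 1) (G := Circle) u1Rep
      continuous_u1Rep β
    unfold wilsonExpectation
    simp only [plaquetteHolonomy_side_one, Circle.coe_one, Complex.one_re, integral_const, smul_eq_mul,
      mul_one, probReal_univ]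
    norm_num
  · classical
    have hχ : u1TorusChars M p = u1PlaqChar p.1 p.2.1.1 p.2.1.2 := rfl
    have hij : p.2.1.1 ≠ p.2.1.2 := ne_of_lt p.2.2
    rw [show (fun U : GaugeConfig 4 (M + 1) Circle =>
        ((plaquetteHolonomy U p.1 p.2.1.1 p.2.1.2 : Circle) : ℂ).re) = reChar (u1TorusChars M p) from rfl,
      wilsonExpectation_u1_eq_ginibreExpect_fun]
    have hsingle := TransverseWardBL.ginibreExpect_single_self (Measure.pi fun _ : Edge 4 (M + 1) => haarProbability Circle) (u1TorusChars M) p β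
      (fun k hk => u1PlaqChar_zpow_eq_one_of hM p.1 hij k (by rw [← hχ]; exact hk))
    calc (9 / 10 : ℝ) ≤ besselI (-1) β / besselI 0 β := TransverseWardBL.besselRatio_ge hβ.le
      _ = ginibreExpect (Measure.pi fun _ : Edge 4 (M + 1) => haarProbability Circle) (u1TorusChars M) (fun a => if a = p then β else 0)
            (reChar (u1TorusChars M p)) := hsingle.symm
      _ ≤ ginibreExpect (Measure.pi fun _ : Edge 4 (M + 1) => haarProbability Circle) (u1TorusChars M) (fun _ => β) (reChar (u1TorusChars M p)) :=
          ginibreExpect_reChar_mono _ (fun θ => exists_mul_self_eq_u1Config θ) _ _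
            (fun a => by by_cases ha : a = p <;> simp [ha, hβ0])
            (fun a => by by_cases ha : a = p <;> simp [ha, hβ0])

/-- **Split child `DefectTail` (stmt-QuantumFields-23008) PROVED**: uniform exponential tail
`W_{β,M}[∏_{p∈P} 1{Re U_p < cos 1}] ≤ exp(−κ β #P)` with `κ = (9/10 − cos 1)/4`, `β > 42`, on EVERY torus
(both parities of the side) and for every finite plaquette set `P` — Chebyshev, coupling tilt, Jensen and
Ginibre (`defectTail_of_allPlaqMeanLower`) on top of the one-point bound `allPlaqMeanLower_proof`.  An
elementary abelian large-field estimate; nothing about the Yang–Mills mass gap is proved. [folklore] -/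
theorem defectTail_proof : Summit.QuantumFields.YangMills.Theses.TransverseWardBL.DefectTail :=
  defectTail_of_allPlaqMeanLower allPlaqMeanLower_proof

end Summit.QuantumFields.YangMills.Theorems.TransverseWardBLDefect
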